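import Literature.Geometry.Kaehler.ComplexTorusCycleClassMap
import HarnessLib

/-!
# The class of an analytic subset of a complex torus is invariant under translations

Layer `Literature/Geometry/Kaehler`; lane `lit-hodgefound`, Layer A4, rows A4-18 (b) / A4-01 (programme
Q58 of `run/shared/lean/pub/lit-hodgefound/SKELETON.md`, leaf (ii) of `lit-hodgefound-p07`: "translation
invariance"). Let `X = E/Λ`, `Λ = Φ(ℤ^ι)`, be a complex torus (`ComplexTorus Φ`), `t ∈ X`, and `Z ⊆ X` a
closed analytic subset of pure dimension `d`. The translation `t_t : x ↦ t + x` is a biholomorphic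
automorphism of `X` (Lange–Birkenhake (1992), §1.1.2: "the translation `t_{x₀}` … is holomorphic"; tree
`ComplexTorus.contMDiff_const_add`), so the translate `t + Z` is again a closed analytic subset of pure
dimension `d` (`ComplexTorus.hasPureDim_vadd`), and **its class equals the class of `Z`**:

* **`ComplexTorus.analyticCyclePeriod_vadd`** — `∫_{t + Z} γ = ∫_Z γ` for every invariant `2d`-form
  `γ ∈ Alt^{2d}_ℝ(E; ℂ) = H^{2d}(X, ℂ)` (the cohomology of `X` IS the space of translation-invariant forms,
  Lange (2023), §1.1.4 Prop. 1.1.20; `⟨[Z], α⟩ = ∫_Z α`, Voisin (2002), §11.1.2 Cor. 11.15). Mechanism,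
  for a lift `b ∈ E` of `t`: `π⁻¹(t + Z) = b + π⁻¹Z` (`liftSet_vadd`); the regular locus, the density
  (`= 1`) and the canonical orientation of the chain `[π⁻¹(t + Z)]` are the translates of those of `[π⁻¹ Z]`
  (regular points are invariant under biholomorphisms, Chirka (1989), §2.3; approximate tangent cones are
  translation-equivariant, Federer (1969), 3.2.16 — tree `approxTangentCone_restrict_preimage_add_smul`);
  the Hausdorff measure `𝓗^{2d}` is translation-invariant and the translate of a period box is a period
  box, over which the `Λ`-periodic chain `[π⁻¹ Z]` has the same periods (`ComplexTorusPeriodicAnalyticSet`);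
* **`ComplexTorus.analyticCycleClass_vadd`** — `[t + Z] = [Z]` in `H^{n−2d}(X, ℂ)`; `setCycleClass_vadd`.

In print: translates of a cycle on an abelian variety are algebraically, hence homologically, equivalent
(Lange (2023), §6.2.1 and Ex. 6.2.5 (1): `𝒵_alg(X) ⊆ 𝒵_hom(X)`; §6.2.3: `t_x^* α = t_{−x *} α`); the fibres
`Z_y` of a family of cycles over a connected base are all homologous (Voisin (2002), §12.1.2 Thm. 12.4).
The de Rham counterpart `t_s^*[ω_c] = [ω_c]` for the constant forms is the tree's
`ComplexTorusForms.lean`.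

Theorems only; no definition, no named fact.

## References

* [LangeBirkenhake1992] H. Lange, Ch. Birkenhake, *Complex Abelian Varieties*, Springer (1992), §1.1.2.
* [Lange2023AbelianVarietiesComplex] H. Lange, *Abelian Varieties over the Complex Numbers*, Springer
  (2023), §1.1.4 Prop. 1.1.20, §6.2.1, Ex. 6.2.5 (1), §6.2.3.
* [VoisinHodgeI2002] C. Voisin, *Hodge Theory and Complex Algebraic Geometry I*, CUP (2002), §11.1.2
  Cor. 11.15, §12.1.2 Thm. 12.4.
* [Chirka1989] E. M. Chirka, *Complex Analytic Sets*, Kluwer (1989), §2.3, §14.1.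
* [Federer1969] H. Federer, *Geometric Measure Theory*, Springer (1969), 2.10.2, 3.2.16.
-/

noncomputable section

open scoped Manifold ENNReal NNReal Pointwise
open MeasureTheory TopologicalSpace Set Function Complex Module
open Literature.Geometry.GeometricMeasureTheory

namespace Literature.Geometry.Kaehler

-- Nested operator-norm instances on `Covector V m` / `Multivector V m`, as in `Currents.lean`.
set_option maxSynthPendingDepth 2

universe u

/-! ### Pure dimension is invariant under biholomorphisms -/

section Biholomorph

variable {E₀ : Type*} [NormedAddCommGroup E₀] [NormedSpace ℂ E₀] {H : Type*} [TopologicalSpace H]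
  {I : ModelWithCorners ℂ E₀ H} {M : Type*} [TopologicalSpace M] [ChartedSpace H M]
  {M' : Type*} [TopologicalSpace M'] [ChartedSpace H M']

/-- **Pure dimension is invariant under biholomorphisms**: if `h : M ≃ₜ M'` is holomorphic with
holomorphic inverse and `Z ⊆ M'` has pure dimension `p`, so has `h ⁻¹' Z` (analytic sets pull back,
regular points and their codimension are invariant under biholomorphisms). [cite: Chirka1989, §2.3] -/
theorem HasPureDim.preimage_homeomorph (h : M ≃ₜ M') (hh : MDifferentiable I I h)
    (hh' : MDifferentiable I I h.symm) {Z : Set M'} {p : ℕ} (hZ : HasPureDim I Z p) :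
    HasPureDim I (h ⁻¹' Z) p := by
  obtain ⟨c, hpc, hZa, hZne, hZreg⟩ := hZ
  refine ⟨c, hpc, hZa.preimage hh, ?_, fun x hx ↦ ?_⟩
  · obtain ⟨y, hy⟩ := hZne
    exact ⟨h.symm y, by rwa [mem_preimage, Homeomorph.apply_symm_apply]⟩
  · exact (hZreg _ (mem_regularLocus_of_preimage_homeomorph h hh hh' hx)).preimage hh
      (surjective_mfderiv_of_homeomorph h hh hh' x)

end Biholomorph

namespace ComplexTorus

/-! ### Translates of analytic subsets of the torus -/

section Torus

variable {ι : Type*} [Fintype ι] {E : Type u} [NormedAddCommGroup E] [NormedSpace ℂ E]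
  (Φ : (ι → ℝ) ≃L[ℝ] E) {d : ℕ}

omit [Fintype ι] in
/-- Membership in a translate: `x ∈ t + Z ↔ −t + x ∈ Z`. [folklore] -/
private theorem mem_vadd_set_iff' (t : ComplexTorus Φ) (Z : Set (ComplexTorus Φ)) (x : ComplexTorus Φ) :
    x ∈ t +ᵥ Z ↔ -t + x ∈ Z := by
  rw [Set.mem_vadd_set_iff_neg_vadd_mem, vadd_eq_add]

omit [Fintype ι] in
/-- The translate `t + Z` is the preimage of `Z` under the translation by `−t`. [cite: LangeBirkenhake1992, §1.1.2] -/
theorem preimage_addLeft_neg (t : ComplexTorus Φ) (Z : Set (ComplexTorus Φ)) :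
    (Homeomorph.addLeft (-t)) ⁻¹' Z = t +ᵥ Z := by
  ext x
  rw [mem_preimage, Homeomorph.coe_addLeft, mem_vadd_set_iff']

/-- **Translations of the torus are biholomorphic** (as `MDifferentiable` self-homeomorphisms; the lift of
`x ↦ t + x` is `z ↦ z + b` for a lift `b` of `t`). [cite: LangeBirkenhake1992, §1.1.2] -/
theorem mdifferentiable_addLeft (t : ComplexTorus Φ) :
    MDifferentiable 𝓘(ℂ, E) 𝓘(ℂ, E) (Homeomorph.addLeft t : ComplexTorus Φ → ComplexTorus Φ) := by
  rw [Homeomorph.coe_addLeft]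
  exact (contMDiff_const_add (𝕜 := ℂ) (n := 1) t).mdifferentiable one_ne_zero

/-- … and so are their inverses (the translations by `−t`). [cite: LangeBirkenhake1992, §1.1.2] -/
theorem mdifferentiable_addLeft_symm (t : ComplexTorus Φ) :
    MDifferentiable 𝓘(ℂ, E) 𝓘(ℂ, E) ((Homeomorph.addLeft t).symm : ComplexTorus Φ → ComplexTorus Φ) := by
  rw [Homeomorph.addLeft_symm]
  exact mdifferentiable_addLeft Φ (-t)

/-- **The translate of a closed analytic subset of the torus is a closed analytic subset.**
[cite: LangeBirkenhake1992, §1.1.2] -/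
theorem isAnalyticSet_vadd {Z : Set (ComplexTorus Φ)} (hZ : IsAnalyticSet 𝓘(ℂ, E) Z) (t : ComplexTorus Φ) :
    IsAnalyticSet 𝓘(ℂ, E) (t +ᵥ Z) := by
  rw [← preimage_addLeft_neg]
  exact hZ.preimage (mdifferentiable_addLeft Φ (-t))

/-- **The translate of an analytic subset of pure dimension `d` has pure dimension `d`.**
[cite: Chirka1989, §2.3] -/
theorem hasPureDim_vadd {Z : Set (ComplexTorus Φ)} (hZ : HasPureDim 𝓘(ℂ, E) Z d) (t : ComplexTorus Φ) :
    HasPureDim 𝓘(ℂ, E) (t +ᵥ Z) d := by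
  rw [← preimage_addLeft_neg]
  exact hZ.preimage_homeomorph (Homeomorph.addLeft (-t)) (mdifferentiable_addLeft Φ (-t))
    (mdifferentiable_addLeft_symm Φ (-t))

/-- `t + Z` has pure dimension `d` iff `Z` has. [cite: Chirka1989, §2.3] -/
theorem hasPureDim_vadd_iff {Z : Set (ComplexTorus Φ)} (t : ComplexTorus Φ) :
    HasPureDim 𝓘(ℂ, E) (t +ᵥ Z) d ↔ HasPureDim 𝓘(ℂ, E) Z d := by
  refine ⟨fun h ↦ ?_, fun h ↦ hasPureDim_vadd Φ h t⟩
  have h' := hasPureDim_vadd Φ h (-t)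
  rwa [neg_vadd_vadd] at h'

/-- **Regular points of the translate are the translates of the regular points**:
`x ∈ reg (t + Z) ↔ −t + x ∈ reg Z`. [cite: Chirka1989, §2.3] -/
theorem mem_regularLocus_vadd_iff (t : ComplexTorus Φ) {Z : Set (ComplexTorus Φ)} {x : ComplexTorus Φ} :
    x ∈ regularLocus 𝓘(ℂ, E) (t +ᵥ Z) ↔ -t + x ∈ regularLocus 𝓘(ℂ, E) Z := by
  constructor
  · intro hx
    rw [← preimage_addLeft_neg] at hx
    have h := mem_regularLocus_of_preimage_homeomorph (I := 𝓘(ℂ, E)) (I' := 𝓘(ℂ, E))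
      (Homeomorph.addLeft (-t)) (mdifferentiable_addLeft Φ (-t)) (mdifferentiable_addLeft_symm Φ (-t)) hx
    simp only [Homeomorph.coe_addLeft] at h
    exact h
  · intro hx
    have hZ : (Homeomorph.addLeft t) ⁻¹' (t +ᵥ Z) = Z := by
      ext y
      rw [mem_preimage, Homeomorph.coe_addLeft, mem_vadd_set_iff', neg_add_cancel_left]
    have hx' : -t + x ∈ regularLocus 𝓘(ℂ, E) ((Homeomorph.addLeft t) ⁻¹' (t +ᵥ Z)) := by rwa [hZ]
    have h := mem_regularLocus_of_preimage_homeomorph (I := 𝓘(ℂ, E)) (I' := 𝓘(ℂ, E))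
      (Homeomorph.addLeft t) (mdifferentiable_addLeft Φ t) (mdifferentiable_addLeft_symm Φ t) hx'
    simp only [Homeomorph.coe_addLeft, add_neg_cancel_left] at h
    exact h

omit [Fintype ι] in
/-- `π(−b) = −π(b)`. [folklore] -/
private theorem cover_neg (b : E) : cover Φ (-b) = -cover Φ b := by
  rw [eq_neg_iff_add_eq_zero, ← cover_add, neg_add_cancel, cover_zero]

omit [Fintype ι] in
/-- **The lift of the translate is the translate of the lift**: `π⁻¹(t + Z) = b + π⁻¹Z` for a lift
`b` of `t`, written as the preimage under the translation `x ↦ −b + x` of the manifold `⊤ : Opens E`.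
[cite: Lange2023AbelianVarietiesComplex, §1.1.4] -/
theorem liftSet_vadd {t : ComplexTorus Φ} {b : E} (hb : cover Φ b = t) (Z : Set (ComplexTorus Φ)) :
    liftSet Φ (t +ᵥ Z) = translateTop (-b) ⁻¹' liftSet Φ Z := by
  ext x
  rw [mem_liftSet_iff, mem_preimage, mem_liftSet_iff, coe_translateTop, cover_add, cover_neg, hb,
    mem_vadd_set_iff']

end Torus

/-! ### The chain of the translate: carrier, density, orientation -/

section Chains

variable {ι : Type*} [Fintype ι] {E : Type u} [NormedAddCommGroup E] [InnerProductSpace ℂ E]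
  [FiniteDimensional ℂ E] [MeasurableSpace E] [BorelSpace E] (Φ : (ι → ℝ) ≃L[ℝ] E) {d : ℕ}

omit [MeasurableSpace E] [BorelSpace E] in
/-- **The carrier `reg π⁻¹(t + Z)` of `[π⁻¹(t + Z)]` is the translate `b + reg π⁻¹Z` of the carrier
of `[π⁻¹ Z]`** (`π b = t`; regular points are invariant under the biholomorphic translations of `X`).
[cite: Chirka1989, §2.3 and §14.1 Cor.] -/
theorem mem_carrier_analyticChain_vadd_iff {Z : Set (ComplexTorus Φ)} (hZ : HasPureDim 𝓘(ℂ, E) Z d)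
    {t : ComplexTorus Φ} {b : E} (hb : cover Φ b = t) (v : E) :
    v ∈ (analyticChain Φ (hasPureDim_vadd Φ hZ t)).carrier ↔ -b + v ∈ (analyticChain Φ hZ).carrier := by
  rw [(analyticChain Φ (hasPureDim_vadd Φ hZ t)).coe_mem_carrier_iff ⟨v, trivial⟩,
    (analyticChain Φ hZ).coe_mem_carrier_iff ⟨-b + v, trivial⟩, analyticChain, analyticChain,
    HolomorphicChain.support_ofSet, HolomorphicChain.support_ofSet, mem_regularLocus_liftSet_iff,
    mem_regularLocus_liftSet_iff, mem_regularLocus_vadd_iff]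
  change -t + cover Φ v ∈ _ ↔ cover Φ (-b + v) ∈ _
  rw [cover_add, cover_neg, hb]

omit [MeasurableSpace E] [BorelSpace E] in
/-- The carrier of `[π⁻¹(t + Z)]` as a preimage: `reg π⁻¹(t + Z) = (v ↦ −b + v)⁻¹(reg π⁻¹Z)`.
[cite: Chirka1989, §2.3 and §14.1 Cor.] -/
theorem carrier_analyticChain_vadd {Z : Set (ComplexTorus Φ)} (hZ : HasPureDim 𝓘(ℂ, E) Z d)
    {t : ComplexTorus Φ} {b : E} (hb : cover Φ b = t) :
    (analyticChain Φ (hasPureDim_vadd Φ hZ t)).carrier = (fun v ↦ -b + v) ⁻¹' (analyticChain Φ hZ).carrier :=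
  Set.ext fun v ↦ mem_carrier_analyticChain_vadd_iff Φ hZ hb v

/-- **The canonical orientation of `[π⁻¹(t + Z)]` at `v` is that of `[π⁻¹ Z]` at `−b + v`**: the
approximate tangent cone of `𝓗^{2d} ⌞ (b + reg π⁻¹Z)` at `v` is that of `𝓗^{2d} ⌞ reg π⁻¹Z` at `−b + v`
(translation equivariance), and the orientation frame is read off the cone. [cite: Federer1969, 3.2.16] -/
theorem orientationFrame_analyticChain_vadd {Z : Set (ComplexTorus Φ)} (hZ : HasPureDim 𝓘(ℂ, E) Z d)
    {t : ComplexTorus Φ} {b : E} (hb : cover Φ b = t) (v : E) :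
    (analyticChain Φ (hasPureDim_vadd Φ hZ t)).orientationFrame v =
      (analyticChain Φ hZ).orientationFrame (-b + v) := by
  letI : InnerProductSpace ℝ E := InnerProductSpace.complexToReal
  have hWm : MeasurableSet (analyticChain Φ hZ).carrier := (analyticChain Φ hZ).isRectifiableData.1
  have hcar : (analyticChain Φ (hasPureDim_vadd Φ hZ t)).carrier =
      (fun y : E ↦ -b + (1 : ℝ) • y) ⁻¹' (analyticChain Φ hZ).carrier := by
    rw [carrier_analyticChain_vadd Φ hZ hb]
    simp only [one_smul]
  have key : approxTangentCone (2 * d) ((μHE[2 * d] : Measure E).restrict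
        (analyticChain Φ (hasPureDim_vadd Φ hZ t)).carrier) v =
      approxTangentCone (2 * d) ((μHE[2 * d] : Measure E).restrict (analyticChain Φ hZ).carrier) (-b + v) := by
    rw [hcar, approxTangentCone_restrict_preimage_add_smul (m := 2 * d) hWm (-b) v one_pos, one_smul]
  unfold HolomorphicChain.orientationFrame
  rw [key]

omit [MeasurableSpace E] [BorelSpace E] in
/-- The density of `[π⁻¹ A]` is `1` on its carrier (restated for `analyticChain`). [cite: Chirka1989, §14.1 Cor., p. 174] -/
private theorem density_analyticChain_eq_one {A : Set (ComplexTorus Φ)} (hA : HasPureDim 𝓘(ℂ, E) A d)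
    {v : E} (hv : v ∈ (analyticChain Φ hA).carrier) : (analyticChain Φ hA).density v = 1 :=
  HolomorphicChain.density_ofSet_of_mem_carrier _ hv

end Chains

/-! ### `∫_{t + Z} γ = ∫_Z γ` and `[t + Z] = [Z]` -/

section Periods

variable {ι : Type*} [Fintype ι] {E : Type u} [NormedAddCommGroup E] [InnerProductSpace ℂ E]
  [FiniteDimensional ℂ E] [MeasurableSpace E] [BorelSpace E] (Φ : (ι → ℝ) ≃L[ℝ] E) {d : ℕ}

omit [NormedAddCommGroup E] [InnerProductSpace ℂ E] [FiniteDimensional ℂ E] [BorelSpace E] in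
/-- A window integral against `μ ⌞ W` as a whole-space integral of an indicator. [folklore] -/
private theorem setIntegral_restrict_eq_integral_indicator {W D : Set E} (hW : MeasurableSet W)
    (hD : MeasurableSet D) (f : E → ℂ) (μ : Measure E) :
    ∫ v in D, f v ∂(μ.restrict W) = ∫ v, (D ∩ W).indicator f v ∂μ := by
  rw [Measure.restrict_restrict hD, integral_indicator (hD.inter hW)]

omit [Fintype ι] [FiniteDimensional ℂ E] [MeasurableSpace E] [BorelSpace E] in
/-- The translate of a period box is a period box: `(w ↦ b + w)⁻¹ Φ(a + [0,1)^ι) = Φ(a − Φ⁻¹b + [0,1)^ι)`.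
[cite: Lange2023AbelianVarietiesComplex, §1.1.1] -/
theorem preimage_const_add_periodBox (b : E) (a : ι → ℝ) :
    (fun w : E ↦ b + w) ⁻¹' periodBox Φ a = periodBox Φ (a - Φ.symm b) := by
  ext w
  simp only [mem_preimage, mem_periodBox_iff, map_add, Pi.add_apply, Pi.sub_apply, Set.mem_Ico]
  refine forall_congr' fun i ↦ ?_
  constructor <;> rintro ⟨h1, h2⟩ <;> constructor <;> linarith

/-- **`∫_{t + Z} γ = ∫_Z γ` for every invariant `2d`-form `γ`: the current of integration on
`H^{2d}(X, ℂ) = Alt^{2d}_ℝ(E; ℂ)` of the translate `t + Z` of a pure `d`-dimensional analytic subset `Z`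
of the torus is that of `Z`.** [cite: VoisinHodgeI2002, §12.1.2 Thm. 12.4] -/
theorem analyticCyclePeriod_vadd {Z : Set (ComplexTorus Φ)} (hZ : HasPureDim 𝓘(ℂ, E) Z d) (t : ComplexTorus Φ) :
    analyticCyclePeriod Φ (hasPureDim_vadd Φ hZ t) = analyticCyclePeriod Φ hZ := by
  obtain ⟨b, hb⟩ := cover_surjective Φ t
  set T := analyticChain Φ hZ with hT
  set T' := analyticChain Φ (hasPureDim_vadd Φ hZ t) with hT'
  set μ : Measure E := μHE[2 * d] with hμ
  set D₁ : Set E := (fun w : E ↦ b + w) ⁻¹' periodBox Φ 0 with hD₁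
  have hD₁' : D₁ = periodBox Φ (0 - Φ.symm b) := preimage_const_add_periodBox Φ b 0
  have hD : MeasurableSet (periodBox Φ (0 : ι → ℝ)) := measurableSet_periodBox Φ 0
  have hD₁m : MeasurableSet D₁ := by rw [hD₁']; exact measurableSet_periodBox Φ _
  ext γ
  -- the two integrands
  set F : E → ℂ := fun w ↦ ((T.density w : ℝ) : ℂ) * γ (T.orientationFrame w) with hF
  set F' : E → ℂ := fun w ↦ ((T'.density w : ℝ) : ℂ) * γ (T'.orientationFrame w) with hF'
  -- pointwise: the integrand of the translate is the translate of the integrand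
  have hpt : ∀ v, (periodBox Φ 0 ∩ T'.carrier).indicator F' v = (D₁ ∩ T.carrier).indicator F (-b + v) := by
    intro v
    by_cases hv : v ∈ T'.carrier
    · have hv' : -b + v ∈ T.carrier := (mem_carrier_analyticChain_vadd_iff Φ hZ hb v).1 hv
      by_cases hbox : v ∈ periodBox Φ 0
      · have hbox' : -b + v ∈ D₁ := by
          change b + (-b + v) ∈ periodBox Φ 0
          rwa [add_neg_cancel_left]
        rw [indicator_of_mem (Set.mem_inter hbox hv), indicator_of_mem (Set.mem_inter hbox' hv'), hF, hF']
        simp only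
        rw [density_analyticChain_eq_one Φ _ hv, density_analyticChain_eq_one Φ hZ hv',
          orientationFrame_analyticChain_vadd Φ hZ hb v]
      · rw [indicator_of_notMem (fun h ↦ hbox h.1), indicator_of_notMem (fun h ↦ hbox ?_)]
        have h1 : b + (-b + v) ∈ periodBox Φ 0 := h.1
        rwa [add_neg_cancel_left] at h1
    · rw [indicator_of_notMem (fun h ↦ hv h.2), indicator_of_notMem (fun h ↦ hv ?_)]
      exact (mem_carrier_analyticChain_vadd_iff Φ hZ hb v).2 h.2
  -- the left-hand side as a whole-space integral, translated, and back
  have hL : analyticCyclePeriod Φ (hasPureDim_vadd Φ hZ t) γ = ∫ v, (periodBox Φ 0 ∩ T'.carrier).indicator F' v ∂μ := by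
    rw [analyticCyclePeriod, HolomorphicChain.torusPeriod_apply]
    exact setIntegral_restrict_eq_integral_indicator T'.isRectifiableData.1 hD F' μ
  have hR : analyticCyclePeriod Φ hZ γ = ∫ v, (D₁ ∩ T.carrier).indicator F v ∂μ := by
    rw [analyticCyclePeriod_eq_constPeriod_periodBox Φ hZ (0 - Φ.symm b),
      T.constPeriod_apply (T.integrableOn_density_smul_frameVector_periodBox Φ _), ← hD₁']
    exact setIntegral_restrict_eq_integral_indicator T.isRectifiableData.1 hD₁m F μ
  rw [hL, hR, show (fun v ↦ (periodBox Φ 0 ∩ T'.carrier).indicator F' v) =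
      fun v ↦ (D₁ ∩ T.carrier).indicator F (-b + v) from funext hpt]
  exact integral_add_left_eq_self _ (-b)

variable [DecidableEq ι] {n k : ℕ} (e : Fin n ≃ ι)

/-- **`[t + Z] = [Z]` in `H^{n−2d}(X, ℂ)`: the class of an analytic subset of a complex torus is invariant
under translations** (translates are algebraically, hence homologically, equivalent: Lange (2023), §6.2.1
with Ex. 6.2.5 (1); Voisin (2002), Thm. 12.4: the fibres of a family of cycles over a connected base are
homologous). [cite: Lange2023AbelianVarietiesComplex, §6.2.1 and Ex. 6.2.5 (1)] -/
theorem analyticCycleClass_vadd (h : 2 * d + k = n) {Z : Set (ComplexTorus Φ)} (hZ : HasPureDim 𝓘(ℂ, E) Z d)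
    (t : ComplexTorus Φ) :
    analyticCycleClass Φ e h (hasPureDim_vadd Φ hZ t) = analyticCycleClass Φ e h hZ := by
  rw [analyticCycleClass, analyticCycleClass, analyticCyclePeriod_vadd]

/-- `[t + Z] = [Z]` for the total set-level class `setCycleClass` (both sides `0` when `Z` is not of pure
dimension `d`). [cite: Lange2023AbelianVarietiesComplex, §6.2.1 and Ex. 6.2.5 (1)] -/
theorem setCycleClass_vadd (h : 2 * d + k = n) (Z : Set (ComplexTorus Φ)) (t : ComplexTorus Φ) :
    setCycleClass Φ e h (t +ᵥ Z) = setCycleClass Φ e h Z := by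
  by_cases hZ : HasPureDim 𝓘(ℂ, E) Z d
  · rw [setCycleClass_of_hasPureDim Φ e h (hasPureDim_vadd Φ hZ t), setCycleClass_of_hasPureDim Φ e h hZ,
      analyticCycleClass_vadd]
  · have hZ' : ¬ HasPureDim 𝓘(ℂ, E) (t +ᵥ Z) d := fun h' ↦ hZ ((hasPureDim_vadd_iff Φ t).1 h')
    rw [setCycleClass, setCycleClass, dif_neg hZ, dif_neg hZ']

/-- `⟨γ, [t + Z]⟩ = ⟨γ, [Z]⟩ = ∫_Z γ`. [cite: VoisinHodgeI2002, §11.1.2 Cor. 11.15] -/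
theorem poincarePairing_analyticCycleClass_vadd (h : 2 * d + k = n) {Z : Set (ComplexTorus Φ)}
    (hZ : HasPureDim 𝓘(ℂ, E) Z d) (t : ComplexTorus Φ) (γ : E [⋀^Fin (2 * d)]→L[ℝ] ℂ) :
    poincarePairing Φ e h γ (analyticCycleClass Φ e h (hasPureDim_vadd Φ hZ t)) = analyticCyclePeriod Φ hZ γ := by
  rw [analyticCycleClass_vadd, poincarePairing_analyticCycleClass]

end Periods

end ComplexTorus

end Literature.Geometry.Kaehler

end
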